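import Literature.AlgebraicGeometry.HodgeTheory.UniversalHypersurfaceFibreCoordinates
import Literature.AlgebraicGeometry.HodgeTheory.CyclicCoverTotalSpacePoints
import Literature.AlgebraicGeometry.HodgeTheory.SpecialisedHypersurfaceFamilyPoints
import Literature.AlgebraicGeometry.HodgeTheory.IsoTransport
import Literature.AlgebraicGeometry.HodgeTheory.HypersurfaceResidueFormDef
import Literature.AlgebraicGeometry.Motives.UniversalHypersurfaceBaseChart
import Literature.AlgebraicGeometry.Motives.HodgeNumberFamilySemicontinuity
import Literature.NumberTheory.Transcendental.AnalytificationFunctorialityProofs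
import Literature.NumberTheory.Transcendental.AnalytificationProofs
import HarnessLib

/-!
# Holomorphic homogeneous coordinates and coefficient functions on the total space of a family of
# hypersurfaces (the inputs of the relative residue forms)

Family `hodge`, layer `Literature/AlgebraicGeometry/HodgeTheory`. Theorems only; no definition, no named
fact. Written by the prover seat `hodge-nonav-prover-Ax` (g12, cell `hodge-nonav`) as brick FF1 of the
programme «GRIFFITHS-SURFACES / B4 RELATIVE RESIDUES» (route `HodgeConjecture/CyclicUnitaryPowers`).

The relative residue forms of `RelativeResidueForms` live on a complex manifold `T` with a map
`ψ_T : T → ℙ ℂ ℂ^{n+2}` of HOLOMORPHIC affine coordinates and HOLOMORPHIC coefficient functions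
`c_m : T → ℂ` writing the equation of the fibre through `y` as `F_y = Σ_m c_m(y) x^m`. This file supplies
these data for the ANALYTIFICATIONS of algebraic families (Serre, GAGA §2: regular functions are
holomorphic):

* §1 `exists_section_evalOrZero_eq_stdChart`, `hasHolomorphicCoords_hypersurfacePoint_comp` — for ANY
  morphism `ι : Y ⟶ ℙⁿ⁺¹_ℂ` (not necessarily a closed immersion) and any analytification
  `φ : M → Y(ℂ)`, the homogeneous-coordinate map `hypersurfacePoint ι ∘ φ : M → ℙ ℂ ℂ^{n+2}` has
  holomorphic affine coordinates: they are the regular functions `ι^*(X_k/X_i)` on the opens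
  `ι⁻¹(D₊(X_i))` (the tree's `hypersurfaceCoordFn` without the affineness packaging), holomorphic by
  `IsAnalytification.mdifferentiableOn_evalOrZero_opens_holds`.
* §2 `mdifferentiable_affineCoords_map_comp` — the affine coordinates of `g(φ y)` for a morphism
  `g : Y ⟶ 𝔸^σ_ℂ` are holomorphic functions on `M` (global regular functions `g^* x_i`).
* §3 The specialised family of smooth hypersurfaces `f = familySpz ℂ n d sp : 𝒴_sp ⟶ S_sp`
  (`SpecialisedHypersurfaceFamily`; the Carlson–Toledo family of cyclic covers is the case
  `sp = cyclicCoverSpz p`): on `T = 𝒴_sp(ℂ)` with its algebraic charts,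
  `ψ_T = hypersurfacePoint (totalSpzToTotal ≫ toProjectiveSpace)` has holomorphic affine coordinates
  (`hasHolomorphicCoords_totalSpz`), the coefficients `y ↦ coeffVector (𝒴_sp → 𝒴_U → U)(y) m` are
  holomorphic (`mdifferentiable_coeff_totalSpz`), the form of the base point is
  `Σ_m c_m(y) • x^m` (`pointForm_eq_sum_coeff_smul_monomial`) and `ψ_T y` lies on it
  (`hypersurfacePoint_totalSpz_mem_projZeroLocus`); on the fibre `X_t = fiberOver f t` the coordinate map
  `ψ_T ∘ (fiberι f t)(ℂ) = hypersurfacePoint (fiberι f t ≫ …)` is a topological embedding with image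
  EXACTLY `{[z] | F_t(z) = 0}`, `F_t = pointFormSpz t` nonsingular homogeneous of degree `d`
  (`isEmbedding_hypersurfacePoint_fiberι_totalSpz`, `range_hypersurfacePoint_fiberι_totalSpz`; through
  `fiberOverFamilyPullbackIso` and the universal family's `range_fibrePoint`).

## References

* [SerreGAGA1956] J.-P. Serre, Géométrie algébrique et géométrie analytique, Ann. Inst. Fourier 6
  (1956), §2 n°5 Lemme 1, Prop. 2, n°6.
* [VoisinHodgeII2003] C. Voisin, Hodge Theory and Complex Algebraic Geometry II (2003), §6.2.1 (the
  universal hypersurface).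
* [Griffiths1969] P. Griffiths, On the periods of certain rational integrals I, Ann. of Math. 90 (1969), §8.
-/

noncomputable section

open scoped Manifold ContDiff Topology
open CategoryTheory AlgebraicGeometry Set
open Literature.NumberTheory.Transcendental Literature.AlgebraicGeometry.Motives
open Literature.AlgebraicGeometry.Motives.UniversalHypersurface
open Literature.AlgebraicGeometry.HodgeTheory.UniversalHypersurface

namespace Literature.AlgebraicGeometry.HodgeTheory

/-! ### §1 Holomorphic affine coordinates of `hypersurfacePoint ι` for any `ι : Y ⟶ ℙⁿ⁺¹` -/

section Coords

variable {n : ℕ} {Y : SchemeOver ℂ} (ι : Y ⟶ Motives.projectiveSpace (n + 1) ℂ)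

/-- **The affine coordinates of `hypersurfacePoint ι` are regular functions on the opens
`ι⁻¹(D₊(X_i))`** (for any morphism `ι : Y ⟶ ℙⁿ⁺¹_ℂ`): the section `ι^*(X_{i.succAbove j}/X_i)` over
`ι⁻¹(D₊(X_i))` takes at `P` the value of the `j`-th affine coordinate of `hypersurfacePoint ι P` in the
`i`-th standard chart (the tree's `evalOrZero_hypersurfaceCoordFn`, whose proof does not use the
affineness of `ι⁻¹(D₊(X_i))`). [cite: SerreGAGA1956, §2 n°5 Lemme 1 c) and Prop. 2] -/
theorem exists_section_evalOrZero_eq_stdChart (i : Fin (n + 2)) (j : Fin (n + 1)) :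
    ∃ s : Γ(Y.left, ι.left ⁻¹ᵁ projChartOpen i), ∀ P : ComplexPoints Y,
      P.pt ∈ ι.left ⁻¹ᵁ projChartOpen i →
        AlgPoints.evalOrZero (ι.left ⁻¹ᵁ projChartOpen i) s P =
          Projectivization.stdChart i (hypersurfacePoint ι P) j := by
  refine ⟨ι.left.app (projChartOpen i) (projRatioSection i (i.succAbove j)), fun P hP ↦ ?_⟩
  -- adapted from the tree's `evalOrZero_hypersurfaceCoordFn` (HypersurfaceComplexPoints)
  have hP' : (AlgPoints.map ι P).pt ∈ projChartOpen i := hP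
  have hsrc : hypersurfacePoint ι P ∈ (Projectivization.stdChart i).source :=
    (pt_map_mem_projChartOpen_iff ι i P).mp hP'
  set v := (hypersurfacePoint ι P).rep with hv
  have hv0 : v ≠ 0 := (hypersurfacePoint ι P).rep_nonzero
  have hmk : Projectivization.mk ℂ v hv0 = hypersurfacePoint ι P := Projectivization.mk_rep _
  have hvi : v i ≠ 0 := by
    rw [← hmk, Projectivization.stdChart_source, Projectivization.mk_mem_stdChartSource_iff] at hsrc
    exact hsrc
  have hmap : AlgPoints.map ι P =
      AlgPoints.map (chartι (n + 1) i) (chartPoint (n + 1) v hvi) := by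
    rw [← projPoint_hypersurfacePoint, ← hmk]
    exact projPoint_mk_eq_map_chartPoint (n + 1) v hvi
  rw [AlgPoints.evalOrZero_of_mem _ hP]
  have step1 : P.eval (ι.left ⁻¹ᵁ projChartOpen i) hP
      (ι.left.app (projChartOpen i) (projRatioSection i (i.succAbove j))) =
      (AlgPoints.map ι P).eval (projChartOpen i) hP' (projRatioSection i (i.succAbove j)) :=
    (AlgPoints.eval_map ι P (projChartOpen i) hP' _).symm
  have h' : (AlgPoints.map (chartι (n + 1) i) (chartPoint (n + 1) v hvi)).pt ∈ projChartOpen i := by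
    rw [← hmap]; exact hP'
  have step2 : (AlgPoints.map ι P).eval (projChartOpen i) hP' (projRatioSection i (i.succAbove j)) =
      (AlgPoints.map (chartι (n + 1) i) (chartPoint (n + 1) v hvi)).eval (projChartOpen i) h'
        (projRatioSection i (i.succAbove j)) := by
    congr 1
  rw [step1, step2, eval_projRatioSection_map_chartPoint, ← hmk, Projectivization.stdChart_apply,
    Projectivization.stdChartFun_mk]

/-- The chart domain `ψ⁻¹(U_i)` of `ψ = hypersurfacePoint ι ∘ φ` is the preimage of the complex points
over the open `ι⁻¹(D₊(X_i))`. [cite: SerreGAGA1956, §2 n°5] -/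
theorem liftDomain_hypersurfacePoint_comp {M : Type*} (φ : M → ComplexPoints Y) (i : Fin (n + 2)) :
    liftDomain (hypersurfacePoint ι ∘ φ) i = φ ⁻¹' {P | P.pt ∈ ι.left ⁻¹ᵁ projChartOpen i} := by
  ext x
  rw [mem_liftDomain_iff, Function.comp_apply, mem_preimage, mem_setOf_eq]
  exact (pt_map_mem_projChartOpen_iff ι i (φ x)).symm

/-- **The homogeneous coordinates of an analytified variety mapping to `ℙⁿ⁺¹` are holomorphic.** For
any morphism `ι : Y ⟶ ℙⁿ⁺¹_ℂ` of a smooth `ℂ`-scheme `Y` locally of finite type and any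
analytification `φ : M → Y(ℂ)` (complex manifold charted on `E`), the map
`hypersurfacePoint ι ∘ φ : M → ℙ ℂ ℂ^{n+2}` has holomorphic affine coordinates
(`HasHolomorphicCoords`): they are the pulled-back regular functions `ι^*(X_k/X_i)`
(`exists_section_evalOrZero_eq_stdChart`), holomorphic on the analytification (Serre: "toute
fonction régulière est holomorphe", `IsAnalytification.mdifferentiableOn_evalOrZero_opens_holds`).
[cite: SerreGAGA1956, §2 n°5 Prop. 2 and n°6] -/
theorem hasHolomorphicCoords_hypersurfacePoint_comp {E : Type*} [NormedAddCommGroup E]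
    [NormedSpace ℂ E] [FiniteDimensional ℂ E] {M : Type*} [TopologicalSpace M] [ChartedSpace E M]
    {e : ℕ} [LocallyOfFiniteType Y.hom] [SmoothOfRelativeDimension e Y.hom]
    {φ : M → ComplexPoints Y} (hφ : IsAnalytification E Y e φ) :
    HasHolomorphicCoords E (hypersurfacePoint ι ∘ φ) := by
  intro i j
  obtain ⟨s, hs⟩ := exists_section_evalOrZero_eq_stdChart ι i j
  rw [liftDomain_hypersurfacePoint_comp]
  refine (IsAnalytification.mdifferentiableOn_evalOrZero_opens_holds hφ (ι.left ⁻¹ᵁ projChartOpen i)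
    s).congr fun x hx ↦ ?_
  exact (hs (φ x) hx).symm

end Coords

/-! ### §2 Affine coordinates of a morphism to affine space are holomorphic -/

section Affine

variable {Y : SchemeOver ℂ} {σ : Type} (g : Y ⟶ affineSpaceOver σ ℂ)

/-- **The coordinates `x_i(g(φ y))` of a morphism `g : Y ⟶ 𝔸^σ_ℂ` are holomorphic functions on an
analytification of `Y`** (`x_i ∘ g` is the global regular function `g^* x_i`,
`AlgPoints.evalOrZero_map`; regular functions are holomorphic). [cite: SerreGAGA1956, §2 n°5 Prop. 2 and n°6] -/
theorem mdifferentiable_affineCoords_map_comp {E : Type*} [NormedAddCommGroup E] [NormedSpace ℂ E]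
    [FiniteDimensional ℂ E] {M : Type*} [TopologicalSpace M] [ChartedSpace E M]
    {e : ℕ} [LocallyOfFiniteType Y.hom] [SmoothOfRelativeDimension e Y.hom]
    {φ : M → ComplexPoints Y} (hφ : IsAnalytification E Y e φ) (i : σ) :
    MDifferentiable 𝓘(ℂ, E) 𝓘(ℂ, ℂ) fun y ↦ AlgPoints.affineCoords (AlgPoints.map g (φ y)) i := by
  have h := IsAnalytification.mdifferentiableOn_evalOrZero_opens_holds hφ (g.left ⁻¹ᵁ ⊤)
    (g.left.app ⊤ (AffineSpace.coord (Spec (.of ℂ)) i))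
  have huniv : φ ⁻¹' {P : ComplexPoints Y | P.pt ∈ g.left ⁻¹ᵁ (⊤ : (affineSpaceOver σ ℂ).left.Opens)} =
      univ := Set.eq_univ_of_forall fun _ ↦ trivial
  rw [huniv] at h
  refine (mdifferentiableOn_univ.1 (h.congr fun y _ ↦ ?_))
  rw [AlgPoints.affineCoords_apply, AlgPoints.evalOrZero_map]

end Affine

/-! ### §3 The specialised family of smooth hypersurfaces -/

section Spz

variable (n d : ℕ) {σ : Type} (sp : CoeffRing ℂ n d →ₐ[ℂ] MvPolynomial σ ℂ)

/-- The form of a point `s` of `U`, written with SCALAR coefficients on the monic monomials: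
`F_s = Σ_m (coeffVector s m) • x^m` (`formOfCoeffs_coeffVector`). This is the shape
`F_y = Σ_s c_s(y) • G_s` of `RelativeResidueForms`. [cite: VoisinHodgeII2003, §6.2.1] -/
theorem pointForm_eq_sum_coeffVector_smul_monomial (s : AlgPoints (base ℂ n d) ℂ) :
    pointForm ℂ n d s =
      ∑ m : DegIndex n d, coeffVector ℂ n d s m • MvPolynomial.monomial m.1 (1 : ℂ) := by
  rw [← formOfCoeffs_coeffVector, formOfCoeffs_def]
  refine Finset.sum_congr rfl fun m _ ↦ ?_
  rw [MvPolynomial.smul_monomial, smul_eq_mul, mul_one]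

/-- The base point in `U` of a point `y` of the total space `𝒴_sp`: going through `𝒴_U` or through
`S_sp` gives the same point (the base-change square commutes). [cite: VoisinHodgeII2003, §6.2.1] -/
theorem map_totalSpzToTotal_family (y : ComplexPoints (totalSpz ℂ n d sp)) :
    AlgPoints.map (family ℂ n d) (AlgPoints.map (totalSpzToTotal ℂ n d sp) y) =
      AlgPoints.map (toBaseSpz ℂ n d sp) (AlgPoints.map (familySpz ℂ n d sp) y) := by
  rw [← AlgPoints.map_comp_apply, ← AlgPoints.map_comp_apply, totalSpzToTotal_comp_family]

/-- **Every point of `𝒴_sp(ℂ)` lies on the hypersurface of its base point**: the homogeneous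
coordinates `hypersurfacePoint (totalSpzToTotal ≫ toProjectiveSpace) y` are a projective zero of the
form `F_t`, `t` the base point of `y` (`d ≥ 1`). [cite: VoisinHodgeII2003, §6.2.1] -/
theorem hypersurfacePoint_totalSpz_mem_projZeroLocus (hd : 1 ≤ d) (y : ComplexPoints (totalSpz ℂ n d sp)) :
    hypersurfacePoint (totalSpzToTotal ℂ n d sp ≫ toProjectiveSpace ℂ n d) y ∈
      Projectivization.projZeroLocus
        {pointForm ℂ n d (AlgPoints.map (toBaseSpz ℂ n d sp) (AlgPoints.map (familySpz ℂ n d sp) y))} := by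
  rw [hypersurfacePoint_comp, ← map_totalSpzToTotal_family]
  exact hypersurfacePoint_mem_projZeroLocus_pointForm n d hd _

/-- **The coefficient functions of the family are holomorphic on the total space**: for every
monomial index `m`, `y ↦ coeffVector (𝒴_sp → 𝒴_U → U)(y) m` — the coefficient of `x^m` in the
equation of the fibre through `y` — is a holomorphic function on any analytification of `𝒴_sp`
(it is the global regular function `a_m` pulled back; §2). [cite: SerreGAGA1956, §2 n°5 Prop. 2 and n°6]
[cite: VoisinHodgeII2003, §6.2.1] -/
theorem mdifferentiable_coeff_totalSpz {E : Type*} [NormedAddCommGroup E] [NormedSpace ℂ E]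
    [FiniteDimensional ℂ E] {M : Type*} [TopologicalSpace M] [ChartedSpace E M]
    {e : ℕ} [LocallyOfFiniteType (totalSpz ℂ n d sp).hom] [SmoothOfRelativeDimension e (totalSpz ℂ n d sp).hom]
    {φ : M → ComplexPoints (totalSpz ℂ n d sp)} (hφ : IsAnalytification E (totalSpz ℂ n d sp) e φ)
    (m : DegIndex n d) :
    MDifferentiable 𝓘(ℂ, E) 𝓘(ℂ, ℂ) fun y ↦
      coeffVector ℂ n d (AlgPoints.map (family ℂ n d) (AlgPoints.map (totalSpzToTotal ℂ n d sp) (φ y))) m := by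
  have h := mdifferentiable_affineCoords_map_comp
    (totalSpzToTotal ℂ n d sp ≫ family ℂ n d ≫ baseToAffineSpace ℂ n d) hφ m
  have hfun : (fun y ↦ coeffVector ℂ n d
        (AlgPoints.map (family ℂ n d) (AlgPoints.map (totalSpzToTotal ℂ n d sp) (φ y))) m) =
      fun y ↦ AlgPoints.affineCoords
        (AlgPoints.map (totalSpzToTotal ℂ n d sp ≫ family ℂ n d ≫ baseToAffineSpace ℂ n d) (φ y)) m := by
    funext y
    rw [coeffVector_eq_comp, Function.comp_apply, AlgPoints.map_comp_apply, AlgPoints.map_comp_apply]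
  rw [hfun]
  exact h

/-- **The homogeneous coordinates on the total space `𝒴_sp(ℂ)` are holomorphic** for any
analytification (§1 applied to `totalSpzToTotal ≫ toProjectiveSpace : 𝒴_sp ⟶ ℙⁿ⁺¹`).
[cite: SerreGAGA1956, §2 n°5 Prop. 2 and n°6] -/
theorem hasHolomorphicCoords_totalSpz {E : Type*} [NormedAddCommGroup E] [NormedSpace ℂ E]
    [FiniteDimensional ℂ E] {M : Type*} [TopologicalSpace M] [ChartedSpace E M]
    {e : ℕ} [LocallyOfFiniteType (totalSpz ℂ n d sp).hom] [SmoothOfRelativeDimension e (totalSpz ℂ n d sp).hom]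
    {φ : M → ComplexPoints (totalSpz ℂ n d sp)} (hφ : IsAnalytification E (totalSpz ℂ n d sp) e φ) :
    HasHolomorphicCoords E (hypersurfacePoint (totalSpzToTotal ℂ n d sp ≫ toProjectiveSpace ℂ n d) ∘ φ) :=
  hasHolomorphicCoords_hypersurfacePoint_comp _ hφ

/-- The fibre coordinate map of `𝒴_sp` over `t` is the universal family's `fibrePoint` over the image
of `t` in `U`, composed with the base-change identification of the fibres
(`fiberOverFamilyPullbackIso`). [cite: VoisinHodgeII2003, §6.2.1] -/
theorem hypersurfacePoint_fiberι_totalSpz_eq (t : ComplexPoints (baseSpz ℂ n d sp))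
    (x : ComplexPoints (fiberOver (familySpz ℂ n d sp) t)) :
    hypersurfacePoint (fiberι (familySpz ℂ n d sp) t ≫ totalSpzToTotal ℂ n d sp ≫ toProjectiveSpace ℂ n d) x =
      fibrePoint n d (AlgPoints.map (toBaseSpz ℂ n d sp) t)
        (AlgPoints.map (fiberOverFamilyPullbackIso (family ℂ n d) (toBaseSpz ℂ n d sp) t).hom x) := by
  rw [fibrePoint_eq_hypersurfacePoint_map_fiberι, ← AlgPoints.map_comp_apply,
    fiberOverFamilyPullbackIso_hom_fiberι, hypersurfacePoint_comp, hypersurfacePoint_comp,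
    AlgPoints.map_comp_apply]
  rfl

/-- **The fibre of `𝒴_sp` over `t` maps homeomorphically onto the hypersurface `{F_t = 0}`**, part 1:
the homogeneous-coordinate map `hypersurfacePoint (fiberι f t ≫ totalSpzToTotal ≫ toProjectiveSpace)`
is a topological embedding. [cite: SerreGAGA1956, §2 n°5 Lemme 1 b)] [cite: VoisinHodgeII2003, §6.2.1] -/
theorem isEmbedding_hypersurfacePoint_fiberι_totalSpz (t : ComplexPoints (baseSpz ℂ n d sp)) :
    Topology.IsEmbedding
      (hypersurfacePoint (fiberι (familySpz ℂ n d sp) t ≫ totalSpzToTotal ℂ n d sp ≫ toProjectiveSpace ℂ n d)) := by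
  have hfun : hypersurfacePoint
      (fiberι (familySpz ℂ n d sp) t ≫ totalSpzToTotal ℂ n d sp ≫ toProjectiveSpace ℂ n d) =
      fibrePoint n d (AlgPoints.map (toBaseSpz ℂ n d sp) t) ∘
        AlgPoints.map (fiberOverFamilyPullbackIso (family ℂ n d) (toBaseSpz ℂ n d sp) t).hom :=
    funext fun x ↦ hypersurfacePoint_fiberι_totalSpz_eq n d sp t x
  rw [hfun]
  exact (isEmbedding_fibrePoint _).comp
    (AlgPoints.isHomeomorph_map_of_iso (L := ℂ) _).isEmbedding

/-- **The fibre of `𝒴_sp` over `t` maps homeomorphically onto the hypersurface `{F_t = 0}`**, part 2: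
the image of the homogeneous-coordinate map is EXACTLY the projective zero locus of
`F_t = pointFormSpz t` (`d ≥ 1`). [cite: VoisinHodgeII2003, §6.2.1] -/
theorem range_hypersurfacePoint_fiberι_totalSpz (hd : 1 ≤ d) (t : ComplexPoints (baseSpz ℂ n d sp)) :
    Set.range
        (hypersurfacePoint (fiberι (familySpz ℂ n d sp) t ≫ totalSpzToTotal ℂ n d sp ≫ toProjectiveSpace ℂ n d)) =
      Projectivization.projZeroLocus {pointFormSpz ℂ n d sp t} := by
  have hfun : hypersurfacePoint
      (fiberι (familySpz ℂ n d sp) t ≫ totalSpzToTotal ℂ n d sp ≫ toProjectiveSpace ℂ n d) =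
      fibrePoint n d (AlgPoints.map (toBaseSpz ℂ n d sp) t) ∘
        AlgPoints.map (fiberOverFamilyPullbackIso (family ℂ n d) (toBaseSpz ℂ n d sp) t).hom :=
    funext fun x ↦ hypersurfacePoint_fiberι_totalSpz_eq n d sp t x
  rw [hfun]
  have hsurj := (AlgPoints.isHomeomorph_map_of_iso (L := ℂ)
    (fiberOverFamilyPullbackIso (family ℂ n d) (toBaseSpz ℂ n d sp) t)).surjective
  refine Set.Subset.antisymm ?_ ?_
  · rintro _ ⟨x, rfl⟩
    have hm := Set.mem_range_self (f := fibrePoint n d (AlgPoints.map (toBaseSpz ℂ n d sp) t))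
      (AlgPoints.map (fiberOverFamilyPullbackIso (family ℂ n d) (toBaseSpz ℂ n d sp) t).hom x)
    rwa [range_fibrePoint hd] at hm
  · intro ℓ hℓ
    rw [← range_fibrePoint hd] at hℓ
    obtain ⟨y, rfl⟩ := hℓ
    obtain ⟨x, rfl⟩ := hsurj y
    exact ⟨x, rfl⟩

/-- The equation of every fibre of `𝒴_sp` is nonsingular and homogeneous of degree `d`, and satisfies
the Jacobian condition of the residue calculus: at every non-zero zero of `F_t` some partial
derivative does not vanish. [cite: VoisinHodgeII2003, §6.2.1] -/
theorem exists_eval_pderiv_pointFormSpz_ne_zero (t : ComplexPoints (baseSpz ℂ n d sp))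
    (z : Fin (n + 2) → ℂ) (hz : z ≠ 0) (hF : MvPolynomial.eval z (pointFormSpz ℂ n d sp t) = 0) :
    ∃ j, MvPolynomial.eval z (MvPolynomial.pderiv j (pointFormSpz ℂ n d sp t)) ≠ 0 :=
  (isNonsingularForm_pointForm ℂ n d _).exists_eval_pderiv_ne_zero hz hF

end Spz

end Literature.AlgebraicGeometry.HodgeTheory

end
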